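import Literature.Analysis.FunctionSpaces.SchwartzTranslationAverage
import HarnessLib

/-!
# Seminorm bounds for Schwartz-weighted averages of translates

Topic `Literature/Analysis/FunctionSpaces`; a complement to `SchwartzTranslationAverage`
(everything proved, no definitions). For the averaging operator
`(K_{A,h} u)(x) = ∫ h(a) u(x − A a) da` of that file the derivatives fall on `u`
(`iteratedFDeriv_translationAverage`), whence the **seminorm bound**

  `p_{k,l}(K_{A,h} u) ≤ 2ᵏ (∫ ‖h(a)‖ (1 + ‖A a‖)ᵏ da) (p_{k,l}(u) + p_{0,l}(u))`

(`seminorm_translationAverage_le`), and in particular, for a weight supported in the ball of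
radius `R`, `p_{k,l}(K_{A,h} u) ≤ 2ᵏ (1 + ‖A‖ R)ᵏ ‖h‖₁ (p_{k,l}(u) + p_{0,l}(u))`
(`seminorm_translationAverage_le_of_support`): averaging a *fixed* Schwartz function against
approximate identities of shrinking support is bounded in every Schwartz seminorm **uniformly in
the support radius** — the form used for time regularisations in Osterwalder–Schrader II
(Comm. Math. Phys. 42 (1975)), Ch. VI.1, where all derivatives must fall on the smooth weights and
never on the sharp time profiles.

## References

* M. Reed, B. Simon, *Methods of Modern Mathematical Physics II* (1975), §IX.1. [ReedSimonII1975]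
* K. Osterwalder, R. Schrader, *Axioms for Euclidean Green's functions II*, Comm. Math. Phys.
  42 (1975) 281–305, Ch. VI.1. [OsterwalderSchraderCMP1975]
-/

noncomputable section

open MeasureTheory Set Filter
open scoped _root_.Topology SchwartzMap FourierTransform

namespace Literature.Analysis.FunctionSpaces.SchwartzAverage

variable {P V : Type*}
  [NormedAddCommGroup P] [InnerProductSpace ℝ P] [FiniteDimensional ℝ P]
  [MeasurableSpace P] [BorelSpace P]
  [NormedAddCommGroup V] [InnerProductSpace ℝ V] [FiniteDimensional ℝ V]

/-- The moment `∫ ‖h(a)‖ (1 + ‖A a‖)ᵏ da` of a Schwartz weight is finite. [folklore] -/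
theorem integrable_norm_mul_one_add_norm_pow (A : P →L[ℝ] V) (h : 𝓢(P, ℂ)) (k : ℕ) :
    Integrable fun a : P => ‖h a‖ * (1 + ‖A a‖) ^ k := by
  have h1 : Integrable fun a : P => (1 + ‖a‖) ^ k * ‖h a‖ :=
    SchwartzMap.integrable_one_add_norm_pow_mul h k
  refine (h1.const_mul (max 1 ‖A‖ ^ k)).mono' (by fun_prop) (Eventually.of_forall fun a => ?_)
  rw [Real.norm_eq_abs, abs_of_nonneg (by positivity)]
  have hA : 1 + ‖A a‖ ≤ max 1 ‖A‖ * (1 + ‖a‖) := by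
    have h2 : ‖A a‖ ≤ ‖A‖ * ‖a‖ := A.le_opNorm a
    have h3 : ‖A‖ * ‖a‖ ≤ max 1 ‖A‖ * ‖a‖ := mul_le_mul_of_nonneg_right (le_max_right _ _) (norm_nonneg _)
    nlinarith [le_max_left 1 ‖A‖, norm_nonneg a]
  calc ‖h a‖ * (1 + ‖A a‖) ^ k ≤ ‖h a‖ * (max 1 ‖A‖ * (1 + ‖a‖)) ^ k := by gcongr
    _ = max 1 ‖A‖ ^ k * ((1 + ‖a‖) ^ k * ‖h a‖) := by rw [mul_pow]; ring

variable [MeasurableSpace V] [BorelSpace V]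

/-- **Seminorm bound for the averaging operator**:
`p_{k,l}(K_{A,h} u) ≤ 2ᵏ (∫ ‖h(a)‖ (1 + ‖A a‖)ᵏ da) (p_{k,l}(u) + p_{0,l}(u))`. [folklore] -/
theorem seminorm_translationAverage_le (A : P →L[ℝ] V) (h : 𝓢(P, ℂ)) (u : 𝓢(V, ℂ)) (k l : ℕ) :
    SchwartzMap.seminorm ℂ k l (translationAverage A h u) ≤
      2 ^ k * (∫ a, ‖h a‖ * (1 + ‖A a‖) ^ k) *
        (SchwartzMap.seminorm ℂ k l u + SchwartzMap.seminorm ℂ 0 l u) := by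
  set S : ℝ := SchwartzMap.seminorm ℂ k l u + SchwartzMap.seminorm ℂ 0 l u with hS
  have hS0 : 0 ≤ S := by positivity
  refine SchwartzMap.seminorm_le_bound ℂ k l _ (by positivity) fun x => ?_
  rw [iteratedFDeriv_translationAverage A h l u x]
  -- pointwise bound of the integrand
  have hpt : ∀ a : P, ‖x‖ ^ k * ‖h a • iteratedFDeriv ℝ l u (x - A a)‖ ≤
      2 ^ k * S * (‖h a‖ * (1 + ‖A a‖) ^ k) := by
    intro a
    rw [norm_smul]
    have h1 : ‖x - A a‖ ^ k * ‖iteratedFDeriv ℝ l u (x - A a)‖ ≤ SchwartzMap.seminorm ℂ k l u :=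
      u.le_seminorm ℂ k l _
    have h2 : ‖iteratedFDeriv ℝ l u (x - A a)‖ ≤ SchwartzMap.seminorm ℂ 0 l u :=
      u.norm_iteratedFDeriv_le_seminorm ℂ l _
    have hx : ‖x‖ ≤ ‖x - A a‖ + ‖A a‖ := by
      calc ‖x‖ = ‖(x - A a) + A a‖ := by rw [sub_add_cancel]
        _ ≤ ‖x - A a‖ + ‖A a‖ := norm_add_le _ _
    -- `‖x‖^k ≤ 2^k (‖x - Aa‖^k + ‖Aa‖^k)`
    have hxk : ‖x‖ ^ k ≤ 2 ^ k * (‖x - A a‖ ^ k + ‖A a‖ ^ k) := by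
      have hm : ‖x‖ ≤ 2 * max ‖x - A a‖ ‖A a‖ := by
        rcases le_total ‖x - A a‖ ‖A a‖ with hc | hc
        · rw [max_eq_right hc]; linarith
        · rw [max_eq_left hc]; linarith
      calc ‖x‖ ^ k ≤ (2 * max ‖x - A a‖ ‖A a‖) ^ k := pow_le_pow_left₀ (norm_nonneg _) hm k
        _ = 2 ^ k * (max ‖x - A a‖ ‖A a‖) ^ k := mul_pow _ _ _
        _ ≤ 2 ^ k * (‖x - A a‖ ^ k + ‖A a‖ ^ k) := by
            gcongr
            rcases le_total ‖x - A a‖ ‖A a‖ with hc | hc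
            · rw [max_eq_right hc]; linarith [pow_nonneg (norm_nonneg (x - A a)) k]
            · rw [max_eq_left hc]; linarith [pow_nonneg (norm_nonneg (A a)) k]
    have hAk : ‖A a‖ ^ k ≤ (1 + ‖A a‖) ^ k :=
      pow_le_pow_left₀ (norm_nonneg _) (by linarith [norm_nonneg (A a)]) k
    have h1k : (1 : ℝ) ≤ (1 + ‖A a‖) ^ k := one_le_pow₀ (by linarith [norm_nonneg (A a)])
    calc ‖x‖ ^ k * (‖h a‖ * ‖iteratedFDeriv ℝ l u (x - A a)‖)
        = ‖h a‖ * (‖x‖ ^ k * ‖iteratedFDeriv ℝ l u (x - A a)‖) := by ring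
      _ ≤ ‖h a‖ * (2 ^ k * (‖x - A a‖ ^ k + ‖A a‖ ^ k) * ‖iteratedFDeriv ℝ l u (x - A a)‖) := by
          gcongr
      _ = ‖h a‖ * 2 ^ k * (‖x - A a‖ ^ k * ‖iteratedFDeriv ℝ l u (x - A a)‖ +
          ‖A a‖ ^ k * ‖iteratedFDeriv ℝ l u (x - A a)‖) := by ring
      _ ≤ ‖h a‖ * 2 ^ k * (SchwartzMap.seminorm ℂ k l u * (1 + ‖A a‖) ^ k +
          (1 + ‖A a‖) ^ k * SchwartzMap.seminorm ℂ 0 l u) := by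
          gcongr ‖h a‖ * 2 ^ k * (?_ + ?_)
          · calc ‖x - A a‖ ^ k * ‖iteratedFDeriv ℝ l u (x - A a)‖ ≤ SchwartzMap.seminorm ℂ k l u * 1 := by
                  rw [mul_one]; exact h1
              _ ≤ SchwartzMap.seminorm ℂ k l u * (1 + ‖A a‖) ^ k :=
                  mul_le_mul_of_nonneg_left h1k (apply_nonneg _ _)
          · exact mul_le_mul hAk h2 (norm_nonneg _) (by positivity)
      _ = 2 ^ k * S * (‖h a‖ * (1 + ‖A a‖) ^ k) := by rw [hS]; ring
  -- integrate
  have hint := integrable_norm_mul_one_add_norm_pow A h k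
  calc ‖x‖ ^ k * ‖∫ a, h a • iteratedFDeriv ℝ l u (x - A a)‖
      ≤ ‖x‖ ^ k * ∫ a, ‖h a • iteratedFDeriv ℝ l u (x - A a)‖ :=
        mul_le_mul_of_nonneg_left (norm_integral_le_integral_norm _) (by positivity)
    _ = ∫ a, ‖x‖ ^ k * ‖h a • iteratedFDeriv ℝ l u (x - A a)‖ := (integral_const_mul _ _).symm
    _ ≤ ∫ a, 2 ^ k * S * (‖h a‖ * (1 + ‖A a‖) ^ k) := by
        refine integral_mono_of_nonneg (Eventually.of_forall fun a => by positivity)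
          (hint.const_mul _) (Eventually.of_forall hpt)
    _ = 2 ^ k * (∫ a, ‖h a‖ * (1 + ‖A a‖) ^ k) * S := by rw [integral_const_mul]; ring

/-- **Uniformity for weights of small support**: if `h` vanishes outside the closed ball of
radius `R`, then `p_{k,l}(K_{A,h} u) ≤ 2ᵏ (1 + ‖A‖ R)ᵏ ‖h‖₁ (p_{k,l}(u) + p_{0,l}(u))`. [folklore] -/
theorem seminorm_translationAverage_le_of_support (A : P →L[ℝ] V) (h : 𝓢(P, ℂ)) (u : 𝓢(V, ℂ))
    {R : ℝ} (hsupp : ∀ a, R < ‖a‖ → h a = 0) (k l : ℕ) :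
    SchwartzMap.seminorm ℂ k l (translationAverage A h u) ≤
      2 ^ k * (1 + ‖A‖ * R) ^ k * (∫ a, ‖h a‖) *
        (SchwartzMap.seminorm ℂ k l u + SchwartzMap.seminorm ℂ 0 l u) := by
  refine (seminorm_translationAverage_le A h u k l).trans ?_
  have hmom : ∫ a, ‖h a‖ * (1 + ‖A a‖) ^ k ≤ (1 + ‖A‖ * R) ^ k * ∫ a, ‖h a‖ := by
    rw [← integral_const_mul]
    refine integral_mono_of_nonneg (Eventually.of_forall fun a => by positivity)
      (h.integrable.norm.const_mul _) (Eventually.of_forall fun a => ?_)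
    by_cases ha : R < ‖a‖
    · simp [hsupp a ha]
    · push Not at ha
      have hA : ‖A a‖ ≤ ‖A‖ * R := (A.le_opNorm a).trans (mul_le_mul_of_nonneg_left ha (norm_nonneg _))
      calc ‖h a‖ * (1 + ‖A a‖) ^ k ≤ ‖h a‖ * (1 + ‖A‖ * R) ^ k := by gcongr
        _ = (1 + ‖A‖ * R) ^ k * ‖h a‖ := mul_comm _ _
  calc 2 ^ k * (∫ a, ‖h a‖ * (1 + ‖A a‖) ^ k) * (SchwartzMap.seminorm ℂ k l u + SchwartzMap.seminorm ℂ 0 l u)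
      ≤ 2 ^ k * ((1 + ‖A‖ * R) ^ k * ∫ a, ‖h a‖) *
        (SchwartzMap.seminorm ℂ k l u + SchwartzMap.seminorm ℂ 0 l u) := by gcongr
    _ = _ := by ring

end Literature.Analysis.FunctionSpaces.SchwartzAverage
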